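import Mathlib
import Summits.AtomisticToContinuum.HydrodynamicLimit.Theorems.ImplosionDichotomyDenseExcursionSonicSlavingFuchsian

/-!
# The analytic branch of the mode system at the repulsive sonic point (complex characteristic form)
# (crux `DenseExcursion`, line `sonic-cavity-renewal` v6, brick (M3a, part 3) for the registered helper `sonicSlaving_of_tube`)

Helper file (`--supports stmt-AtomisticToContinuum-12586`, line lead a2, stub-worker W2 for `sonicSlaving_of_tube`).

For a profile extended holomorphically to the disc `‖z‖ < 1/10` (`cavityTube_complex_extension`, `…SonicSlavingAnalyticProfile`) with
REAL sonic data `Wc 0 + Sc 0 = 1`, `κ = −(Wc′ + Sc′)(0) ≠ 0`, `c₋(0) = Wc 0 − 1 − Sc 0 ≠ 0`, and `Im Λ ≠ 0`, the characteristic system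
  `c₊ P′ = (Λ − b₊₊) P − b₊₋ M`, `c₋ M′ = −b₋₊ P + (Λ − b₋₋) M`  (`c± = Wc − 1 ± Sc`, coefficients of `mode_char_system`)
has, for every `m₀ : ℂ`, a HOLOMORPHIC solution `(P, M)` on a disc `‖z‖ < δ` with `M 0 = m₀` (`analyticBranch_char_system`, registered
helper). Proof: with `k = −c₊/z` (the `dslope` of `c₊` at `0`, `k(0) = κ`) the system is `z v′ = E(z) v`,
`E = [[−(Λ − b₊₊)/k, b₊₋/k], [−z b₋₊/c₋, z(Λ − b₋₋)/c₋]]`, holomorphic at `0`, `E(0) = [[ν, β], [0, 0]]`, `Im ν = Im Λ/κ ≠ 0`: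
`fuchsian2_analytic_solution` (`…SonicSlavingFuchsian`) applies, and the vector equation unpacks to the two scalar ones (the second at
`z = 0` by continuity). Step (M3a) of the worker report `work/stubs/W2_sonicSlaving.REPORT.md`. No citation is load-bearing.
-/

noncomputable section

open Set Filter Metric
open scoped Topology

namespace Summit.AtomisticToContinuum.HydrodynamicLimit.Theorems.SonicCavityRenewal

/-- Components of a differentiable `V : ℂ → ℂ × ℂ`: `z ↦ (V z).1` has derivative `(deriv V z).1`, and likewise for `.2`. [folklore] -/
theorem hasDerivAt_components {V : ℂ → ℂ × ℂ} {z : ℂ} (hV : DifferentiableAt ℂ V z) :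
    HasDerivAt (fun w => (V w).1) (deriv V z).1 z ∧ HasDerivAt (fun w => (V w).2) (deriv V z).2 z :=
  ⟨(ContinuousLinearMap.fst ℂ ℂ ℂ).hasFDerivAt.comp_hasDerivAt z hV.hasDerivAt,
    (ContinuousLinearMap.snd ℂ ℂ ℂ).hasFDerivAt.comp_hasDerivAt z hV.hasDerivAt⟩

/-- Two functions continuous at `0` that agree on a punctured ball around `0` agree at `0`. [folklore] -/
theorem eq_at_zero_of_eqOn_punctured {g₁ g₂ : ℂ → ℂ} {δ : ℝ} (hδ : 0 < δ) (h₁ : ContinuousAt g₁ 0) (h₂ : ContinuousAt g₂ 0)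
    (heq : ∀ z ∈ ball (0 : ℂ) δ, z ≠ 0 → g₁ z = g₂ z) : g₁ 0 = g₂ 0 := by
  have t₁ : Tendsto g₁ (𝓝[≠] (0 : ℂ)) (𝓝 (g₁ 0)) := h₁.continuousWithinAt.tendsto
  have t₂ : Tendsto g₂ (𝓝[≠] (0 : ℂ)) (𝓝 (g₂ 0)) := h₂.continuousWithinAt.tendsto
  have hev : g₁ =ᶠ[𝓝[≠] (0 : ℂ)] g₂ :=
    eventually_nhdsWithin_iff.2 (eventually_of_mem (ball_mem_nhds 0 hδ) fun z hz hz0 => heq z hz hz0)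
  exact tendsto_nhds_unique (t₁.congr' hev) t₂

/-- **THE ANALYTIC BRANCH OF THE MODE SYSTEM AT THE SONIC POINT** — registered helper `analyticBranch_char_system` for
`sonicSlaving_of_tube`. Let `Wc, Sc` be holomorphic on `‖z‖ < 1/10` with real sonic data `Wc 0 = W₀`, `Sc 0 = S₀`, `Wc′ 0 = W₁`,
`Sc′ 0 = S₁`, `W₀ + S₀ = 1`, `W₁ + S₁ ≠ 0`, `W₀ − 1 − S₀ ≠ 0`, and let `Im Λ ≠ 0`. For every `m₀` there are `0 < δ ≤ 1/10` and
holomorphic `P, M` on `‖z‖ < δ` with `M 0 = m₀` solving the complex characteristic system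
`(Wc − 1 + Sc) P′ = (Λ − b₊₊) P − b₊₋ M`, `(Wc − 1 − Sc) M′ = −b₋₊ P + (Λ − b₋₋) M` (coefficients as in `mode_char_system` with `Wc, Sc`
in place of `W, S`). [folklore] -/
theorem analyticBranch_char_system : ∀ (Wc Sc : ℂ → ℂ) (W₀ S₀ W₁ S₁ r : ℝ) (Λ m₀ : ℂ), AnalyticOnNhd ℂ Wc (Metric.ball 0 (1 / 10)) → AnalyticOnNhd ℂ Sc (Metric.ball 0 (1 / 10)) → Wc 0 = W₀ → Sc 0 = S₀ → deriv Wc 0 = W₁ → deriv Sc 0 = S₁ → W₀ + S₀ = 1 → W₁ + S₁ ≠ 0 → W₀ - 1 - S₀ ≠ 0 → Λ.im ≠ 0 → ∃ δ : ℝ, 0 < δ ∧ δ ≤ 1 / 10 ∧ ∃ P M : ℂ → ℂ, DifferentiableOn ℂ P (Metric.ball 0 δ) ∧ DifferentiableOn ℂ M (Metric.ball 0 δ) ∧ M 0 = m₀ ∧ ∀ z ∈ Metric.ball 0 δ, (Wc z - 1 + Sc z) * deriv P z = (Λ - (2 / 3 * deriv Wc z + 2 * Wc z - r + 2 * deriv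 Sc z + 4 * Sc z)) * P z - (deriv Wc z / 3 + deriv Sc z + 2 * Sc z) * M z ∧ (Wc z - 1 - Sc z) * deriv M z = -(deriv Wc z / 3 - deriv Sc z - 2 * Sc z) * P z + (Λ - (2 / 3 * deriv Wc z + 2 * Wc z - r - 2 * deriv Sc z - 4 * Sc z)) * M z := by
  intro Wc Sc W₀ S₀ W₁ S₁ r Λ m₀ hWa hSa h0W h0S h1W h1S hsonic hκ hcm hΛ
  have h0 : (0 : ℂ) ∈ ball (0 : ℂ) (1 / 10) := mem_ball_self (by norm_num)
  have hW0 : AnalyticAt ℂ Wc 0 := hWa 0 h0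
  have hS0 : AnalyticAt ℂ Sc 0 := hSa 0 h0
  have hdW0 : AnalyticAt ℂ (deriv Wc) 0 := hW0.deriv
  have hdS0 : AnalyticAt ℂ (deriv Sc) 0 := hS0.deriv
  -- coefficient functions
  set cp : ℂ → ℂ := fun z => Wc z - 1 + Sc z with hcp
  set cm : ℂ → ℂ := fun z => Wc z - 1 - Sc z with hcm'
  set bpp : ℂ → ℂ := fun z => 2 / 3 * deriv Wc z + 2 * Wc z - r + 2 * deriv Sc z + 4 * Sc z with hbpp
  set bpm : ℂ → ℂ := fun z => deriv Wc z / 3 + deriv Sc z + 2 * Sc z with hbpm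
  set bmp : ℂ → ℂ := fun z => deriv Wc z / 3 - deriv Sc z - 2 * Sc z with hbmp
  set bmm : ℂ → ℂ := fun z => 2 / 3 * deriv Wc z + 2 * Wc z - r - 2 * deriv Sc z - 4 * Sc z with hbmm
  set k : ℂ → ℂ := fun z => -dslope cp 0 z with hk
  have hcpA : AnalyticAt ℂ cp 0 := (hW0.sub analyticAt_const).add hS0
  have hcmA : AnalyticAt ℂ cm 0 := (hW0.sub analyticAt_const).sub hS0
  have hbppA : AnalyticAt ℂ bpp 0 := by
    simp only [hbpp]
    exact ((((analyticAt_const.mul hdW0).add (analyticAt_const.mul hW0)).sub analyticAt_const).add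
      (analyticAt_const.mul hdS0)).add (analyticAt_const.mul hS0)
  have hbpmA : AnalyticAt ℂ bpm 0 := by
    simp only [hbpm]
    exact ((hdW0.div analyticAt_const (by norm_num)).add hdS0).add (analyticAt_const.mul hS0)
  have hbmpA : AnalyticAt ℂ bmp 0 := by
    simp only [hbmp]
    exact ((hdW0.div analyticAt_const (by norm_num)).sub hdS0).sub (analyticAt_const.mul hS0)
  have hbmmA : AnalyticAt ℂ bmm 0 := by
    simp only [hbmm]
    exact ((((analyticAt_const.mul hdW0).add (analyticAt_const.mul hW0)).sub analyticAt_const).sub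
      (analyticAt_const.mul hdS0)).sub (analyticAt_const.mul hS0)
  have hkA : AnalyticAt ℂ k 0 := by
    -- `dslope` of an analytic germ is analytic (`has_fpower_series_dslope_fslope`; cf. `analyticAt_dslope` of
    -- `Literature/NumberTheory/Automorphic/GreenRhoEichlerIntegral.lean`, not imported to keep the closure small)
    obtain ⟨p, hp⟩ := hcpA
    have hds : AnalyticAt ℂ (dslope cp 0) 0 := ⟨_, hp.has_fpower_series_dslope_fslope⟩
    exact hds.neg
  -- values at the sonic point
  have hcp0 : cp 0 = 0 := by
    simp only [hcp, h0W, h0S]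
    have : ((W₀ : ℝ) : ℂ) + ((S₀ : ℝ) : ℂ) = 1 := by exact_mod_cast hsonic
    linear_combination this
  have hcm0 : cm 0 ≠ 0 := by
    simp only [hcm', h0W, h0S]
    exact_mod_cast hcm
  have hdcp : deriv cp 0 = ((W₁ + S₁ : ℝ) : ℂ) := by
    have hd : HasDerivAt cp (deriv Wc 0 + deriv Sc 0) 0 :=
      (hW0.differentiableAt.hasDerivAt.sub_const 1).add hS0.differentiableAt.hasDerivAt
    rw [hd.deriv, h1W, h1S]
    push_cast
    ring
  have hk0 : k 0 = -((W₁ + S₁ : ℝ) : ℂ) := by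
    simp only [hk, dslope_same, hdcp]
  have hk0ne : k 0 ≠ 0 := by
    rw [hk0, neg_ne_zero]
    exact_mod_cast hκ
  have hkcp : ∀ z, -(k z * z) = cp z := by
    intro z
    have h := sub_smul_dslope cp 0 z
    rw [sub_zero, smul_eq_mul, hcp0, sub_zero] at h
    simp only [hk]
    linear_combination h
  -- the entries of `E`
  set e₁₁ : ℂ → ℂ := fun z => -(Λ - bpp z) / k z with he₁₁
  set e₁₂ : ℂ → ℂ := fun z => bpm z / k z with he₁₂
  set e₂₁ : ℂ → ℂ := fun z => -(z * bmp z) / cm z with he₂₁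
  set e₂₂ : ℂ → ℂ := fun z => z * (Λ - bmm z) / cm z with he₂₂
  have hA₁₁ : AnalyticAt ℂ e₁₁ 0 := (analyticAt_const.sub hbppA).neg.div hkA hk0ne
  have hA₁₂ : AnalyticAt ℂ e₁₂ 0 := hbpmA.div hkA hk0ne
  have hA₂₁ : AnalyticAt ℂ e₂₁ 0 := (analyticAt_id.mul hbmpA).neg.div hcmA hcm0
  have hA₂₂ : AnalyticAt ℂ e₂₂ 0 := (analyticAt_id.mul (analyticAt_const.sub hbmmA)).div hcmA hcm0
  have hz₂₁ : e₂₁ 0 = 0 := by simp [he₂₁]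
  have hz₂₂ : e₂₂ 0 = 0 := by simp [he₂₂]
  have hν : (e₁₁ 0).im ≠ 0 := by
    have hb0 : bpp 0 = ((2 / 3 * W₁ + 2 * W₀ - r + 2 * S₁ + 4 * S₀ : ℝ) : ℂ) := by
      simp only [hbpp, h0W, h0S, h1W, h1S]
      push_cast
      ring
    simp only [he₁₁, hk0, hb0]
    rw [neg_div_neg_eq, Complex.div_ofReal_im, Complex.sub_im, Complex.ofReal_im, sub_zero]
    exact div_ne_zero hΛ hκ
  -- the analytic solution of `z v′ = E v`
  obtain ⟨δ₁, hδ₁, V, hVd, hV0, hVeq⟩ := fuchsian2_analytic_solution e₁₁ e₁₂ e₂₁ e₂₂ hA₁₁ hA₁₂ hA₂₁ hA₂₂ hz₂₁ hz₂₂ hν m₀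
  -- a smaller disc where `k ≠ 0`, `c₋ ≠ 0`
  obtain ⟨δ₂, hδ₂, hk2⟩ : ∃ δ₂ > 0, ∀ z ∈ ball (0 : ℂ) δ₂, k z ≠ 0 ∧ cm z ≠ 0 := by
    have h := (hkA.continuousAt.eventually_ne hk0ne).and (hcmA.continuousAt.eventually_ne hcm0)
    obtain ⟨δ₂, hδ₂, hball⟩ := Metric.eventually_nhds_iff.1 h
    exact ⟨δ₂, hδ₂, fun z hz => hball (by simpa [dist_zero_right] using hz)⟩
  set δ : ℝ := min (min δ₁ δ₂) (1 / 10) with hδ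
  have hδ0 : 0 < δ := lt_min (lt_min hδ₁ hδ₂) (by norm_num)
  have hδδ₁ : δ ≤ δ₁ := (min_le_left _ _).trans (min_le_left _ _)
  have hδδ₂ : δ ≤ δ₂ := (min_le_left _ _).trans (min_le_right _ _)
  have hsub₁ : ball (0 : ℂ) δ ⊆ ball 0 δ₁ := ball_subset_ball hδδ₁
  -- the components
  set P : ℂ → ℂ := fun z => (V z).1 with hP
  set M : ℂ → ℂ := fun z => (V z).2 with hM
  have hVz : ∀ z ∈ ball (0 : ℂ) δ, DifferentiableAt ℂ V z := fun z hz =>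
    hVd.differentiableAt (isOpen_ball.mem_nhds (hsub₁ hz))
  have hdP : ∀ z ∈ ball (0 : ℂ) δ, deriv P z = (deriv V z).1 := fun z hz => (hasDerivAt_components (hVz z hz)).1.deriv
  have hdM : ∀ z ∈ ball (0 : ℂ) δ, deriv M z = (deriv V z).2 := fun z hz => (hasDerivAt_components (hVz z hz)).2.deriv
  have hPd : DifferentiableOn ℂ P (ball 0 δ) := fun z hz => (hasDerivAt_components (hVz z hz)).1.differentiableAt.differentiableWithinAt
  have hMd : DifferentiableOn ℂ M (ball 0 δ) := fun z hz => (hasDerivAt_components (hVz z hz)).2.differentiableAt.differentiableWithinAt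
  -- first equation, everywhere on the disc
  have eq1 : ∀ z ∈ ball (0 : ℂ) δ, cp z * deriv P z = (Λ - bpp z) * P z - bpm z * M z := by
    intro z hz
    have hkz : k z ≠ 0 := (hk2 z (ball_subset_ball hδδ₂ hz)).1
    have h := congrArg Prod.fst (hVeq z (hsub₁ hz))
    simp only [Prod.smul_fst, smul_eq_mul] at h
    rw [hdP z hz, ← hkcp z]
    have h' : -(k z * z) * (deriv V z).1 = -k z * (e₁₁ z * (V z).1 + e₁₂ z * (V z).2) := by rw [← h]; ring
    rw [h']
    simp only [he₁₁, he₁₂, hP, hM]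
    field_simp
    ring
  -- second equation, off `0` by cancelling `z`, at `0` by continuity
  have eq2' : ∀ z ∈ ball (0 : ℂ) δ, z ≠ 0 → cm z * deriv M z = -bmp z * P z + (Λ - bmm z) * M z := by
    intro z hz hz0
    have hcz : cm z ≠ 0 := (hk2 z (ball_subset_ball hδδ₂ hz)).2
    have h := congrArg Prod.snd (hVeq z (hsub₁ hz))
    simp only [Prod.smul_snd, smul_eq_mul] at h
    rw [hdM z hz]
    have h' : z * (cm z * (deriv V z).2) = z * (-bmp z * (V z).1 + (Λ - bmm z) * (V z).2) := by
      calc z * (cm z * (deriv V z).2) = cm z * (z * (deriv V z).2) := by ring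
        _ = cm z * (e₂₁ z * (V z).1 + e₂₂ z * (V z).2) := by rw [h]
        _ = z * (-bmp z * (V z).1 + (Λ - bmm z) * (V z).2) := by
            simp only [he₂₁, he₂₂]
            field_simp
    exact mul_left_cancel₀ hz0 h'
  have eq2 : ∀ z ∈ ball (0 : ℂ) δ, cm z * deriv M z = -bmp z * P z + (Λ - bmm z) * M z := by
    intro z hz
    by_cases hz0 : z ≠ 0
    · exact eq2' z hz hz0
    push Not at hz0
    subst hz0
    -- continuity of both sides at `0`
    have hball : ball (0 : ℂ) δ ∈ 𝓝 (0 : ℂ) := ball_mem_nhds 0 hδ0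
    have hVa : AnalyticAt ℂ V 0 := hVd.analyticAt (isOpen_ball.mem_nhds (mem_ball_self hδ₁))
    have hdVc : ContinuousAt (deriv V) 0 := hVa.deriv.continuousAt
    have hdMc : ContinuousAt (deriv M) 0 := by
      have h : ContinuousAt (fun z => (deriv V z).2) 0 := hdVc.snd
      refine h.congr ?_
      exact eventually_of_mem hball fun z hz => (hdM z hz).symm
    have hVc : ContinuousAt V 0 := (hVz 0 (mem_ball_self hδ0)).continuousAt
    have hWc : ContinuousAt Wc 0 := hW0.continuousAt
    have hSc : ContinuousAt Sc 0 := hS0.continuousAt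
    have hdWc : ContinuousAt (deriv Wc) 0 := hdW0.continuousAt
    have hdSc : ContinuousAt (deriv Sc) 0 := hdS0.continuousAt
    have hg₁ : ContinuousAt (fun z => cm z * deriv M z) 0 := by
      simp only [hcm']
      exact ((hWc.sub continuousAt_const).sub hSc).mul hdMc
    have hg₂ : ContinuousAt (fun z => -bmp z * P z + (Λ - bmm z) * M z) 0 := by
      simp only [hbmp, hbmm, hP, hM]
      have hP' : ContinuousAt (fun z => (V z).1) 0 := hVc.fst
      have hM' : ContinuousAt (fun z => (V z).2) 0 := hVc.snd
      exact ((((hdWc.div_const 3).sub hdSc).sub (continuousAt_const.mul hSc)).neg.mul hP').add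
        ((continuousAt_const.sub (((((continuousAt_const.mul hdWc).add (continuousAt_const.mul hWc)).sub
          continuousAt_const).sub (continuousAt_const.mul hdSc)).sub (continuousAt_const.mul hSc))).mul hM')
    exact eq_at_zero_of_eqOn_punctured hδ0 hg₁ hg₂ fun z hz hz0 => eq2' z hz hz0
  refine ⟨δ, hδ0, min_le_right _ _, P, M, hPd, hMd, by simp [hM, hV0], fun z hz => ⟨eq1 z hz, eq2 z hz⟩⟩

end Summit.AtomisticToContinuum.HydrodynamicLimit.Theorems.SonicCavityRenewal

end
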